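import Summits.FinalStateConjecture.FinalStateConjecture.Theses.LambdaRegulator

/-!
# Birth skeleton for crux `LimitTransport` (stmt-FinalStateConjecture-17441) of route
`LambdaRegulator` — file `Cruxes/LimitTransport/Lines/birth.lean` (BC3, skeleton-register).

The crux is the Λ → 0⁺ dictionary made load-bearing: for EVERY admissible Λ = 0 datum `D`, the
anchored uniform Λ-settling property `Φ(D)` (byte-identical with the property of
`UniformLambdaSettling`: a regularising family `F`, `F 0 = D`, and ONE H-independent configuration —
`N` sub-extremal Kerr parameters with orthochronous motions, `τ₀`, sublinear excisions, `U₀`, moduli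
`μ, μ₀ → 0`, slacks `σ, σ₀ → 0` as `H → 0⁺` locally uniformly in chart time, age envelopes
`A, A₀ < ∞`, separation times, honest radii `Rgᵢ → ∞` — such that every Λ = 3H²-MGHD of `F(H)`,
`0 < H ≤ H₀`, has complete `𝓘⁺` and anchored late Kerr / flat charts with the Statement's clauses)
implies the re-typed Statement's ∀-MGHD clause for `D` itself: every Λ = 0 MGHD `𝒟` of `D` has
complete `𝓘⁺` (sojourn form) and a `C²` final-state decomposition `d` of
`O = exteriorOf 𝒟 d.charted` with sub-extremal holes, `RaysStayInClosure 𝒟 O`,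
`HasExhaustiveCharts d`, `IsFutureOriented d`.

It is cut along the route's own reading of the mechanism ("Cauchy stability in H on the anchored
slabs, diagonal extraction of charts, limits of causal curves in compact regions; the global
clauses — complete `𝓘⁺`, complete rays in `closure O` — are the delicate part"): one LOCAL
transport stub that lands an H-free chart package in the Λ = 0 MGHD, and the two GLOBAL clauses as
separate stubs stated over the settled exterior the package yields (as weak as the assembly allows).

* `stub_chartTransport` — CAUCHY-STABILITY TRANSPORT OF THE ANCHORED CHARTS (load-bearing):
  `Φ(D)` ⇒ every Λ = 0 MGHD `𝒟` of `D` carries a `LimitChartPackage`: the H-free configuration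
  (`N`, sub-extremal `(Mᵢ, aᵢ)`, orthochronous `(Λᵢ, cᵢ)`, `τ₀`, `ρᵢ = o(t)`, `U₀`, `μ, μ₀ → 0`,
  `τsep`, honest `Rgᵢ → ∞` with `μ(Rgᵢ(τ), τ) → 0`) together with late charts `Ψᵢ, Ψ₀` into
  `O := J⁺(ιX) ∩ I⁻(charted)` whose `C²` deviations obey the SLACK-FREE bounds `≤ μ(R, τ)`,
  `≤ μ₀(τ)` (`τ > τ₀`), tubes disjoint after `τsep(R)`, the covering clause at `τ₀`, eventually
  future-directed push-forwards of `Λᵢ V_{Mᵢ,aᵢ}` and `∂₀`, and exhaustiveness of `O` by the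
  certified slabs with radii `Rgᵢ`. Mechanism: the level-H charts live on slabs of Lorentzian age
  `≤ A(R, τ) < ∞` from `ι_H X` (the anchor), where Cauchy stability of the Einstein flow in the
  parameter `H` (jointly smooth data family, `F(H) → D`) applies on compact domains of dependence;
  `σ(H) → 0` locally uniformly in `τ` removes the slack in the limit; charts are extracted
  diagonally in `R, τ`; disjointness / orientation / covering / exhaustiveness are statements about
  compact pieces of causal pasts and pass to `C²`-limits of metrics. Why it might fail: `Φ` gives
  `C²` control only (a derivative may be lost in the extraction), and the covering and exhaustiveness
  inclusions involve `J⁻` of non-compact slabs. Size L–XL.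
* `stub_scriTransport` — COMPLETE `𝓘⁺` OF THE Λ = 0 MGHD: under `Φ(D)`, every MGHD `𝒟` of `D`
  which carries a settled exterior `(O, d)` (sub-extremal holes, `O = exteriorOf 𝒟 d.charted`,
  `HasExhaustiveCharts d`, `IsFutureOriented d`) has complete future null infinity in the sojourn
  form. Two mechanisms are admissible: transport of the level-H sojourn bounds through the anchor
  (ages `A₀(τ) < ∞` make the sojourn regions `J⁺(ι B₀)` of level H and level 0 comparable on compact
  sets), or directly at Λ = 0 from the radiation zone of `d` (outgoing null geodesics in the
  `C²`-asymptotically-Minkowskian flat chart, which contains `{x⁰ > τ₀}` minus sublinear tubes, have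
  unbounded affine length; sojourn times in `J⁺(ι B₀)` grow without bound). Why it might fail:
  completeness of `𝓘⁺` is global — Cauchy stability is finite-time (Kroon 2022, Thm 12.3) and a
  Λ = 0-naked yet Λ > 0-censored datum would break the transport; the direct mechanism needs the
  rays to reach the radiation zone (weak cosmic censorship content). Size L.
* `stub_raysTransport` — COMPLETE RAYS STAY IN THE CLOSED SETTLED EXTERIOR: under `Φ(D)`, in every
  MGHD of `D` with complete `𝓘⁺`, for every settled exterior `(O, d)` as above,
  `RaysStayInClosure 𝒟 O`. This is implied by the shared ∀-datum crux `SettledExteriorHoldsRays`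
  of routes `RaychaudhuriBlowdown` / `TangentConeAtIPlus` (which drops the hypothesis `Φ(D)`);
  the line may instead transport the level-H clause `RaysStayInClosure 𝒟_H O_H`. Why it might
  fail: a future-complete null ray from `Σ` trapped inside a dynamical `N ≥ 2` black-hole interior
  (unknown interiors), or orbiting where no chart certifies. Size L.

`LimitTransport_of` assembles them with a real construction: the package of `stub_chartTransport`
is turned into a `FinalStateDecomposition 𝒟.toSpacetime O 2` (masses positive by sub-extremality,
`|aᵢ| ≤ Mᵢ`; the two convergence fields and the honest-radius convergence of `HasExhaustiveCharts`
by squeezing the slack-free bounds against `μ(R, ·) → 0`, `μ₀ → 0`, `μ(Rgᵢ(τ), τ) → 0`; eventual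
disjointness from `τsep`; excision, flat domain, covering, exhaustiveness and orientation clauses
verbatim; `O = exteriorOf 𝒟 d.charted` definitionally), then `stub_scriTransport` gives complete
`𝓘⁺` and `stub_raysTransport` the ray clause. Sorries live only in the three stubs.
Disproof used: none exists for this crux (`ledger crux ls stmt-FinalStateConjecture-17441`: no
workfiles, no ideas, 2026-08-17); negatives index: no refuted statement of the summit is an
instance of a stub (the stubs are ∀-datum consequences of the Statement's own clause set).
-/

namespace Summit.FinalStateConjecture.FinalStateConjecture.Cruxes.LimitTransport.Birth

open scoped BigOperators Topology Manifold Classical MeasureTheory ProbabilityTheory Matrix InnerProductSpace ComplexConjugate ContinuousMap ContDiff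
open Filter Set Function TopologicalSpace MeasureTheory
open Literature.Geometry.Lorentzian Summit.FinalStateConjecture

/-! ## The two shapes the stubs are stated over -/

/-- `Φ(D)` — the ANCHORED UNIFORM Λ-SETTLING PROPERTY of the datum `D`: the hypothesis of the crux
`LimitTransport`, byte-identical (and byte-identical with the property of `UniformLambdaSettling`). -/
def AnchoredSettling (X : Type) [TopologicalSpace X] [ChartedSpace E3 X] [IsManifold (𝓡 3) ∞ X]
    [T2Space X] [SecondCountableTopology X] [ConnectedSpace X] (D : InitialDataSet (𝓡 3) X) : Prop :=
  ∃ (F : EuclideanSpace ℝ (Fin 1) → InitialDataSet (𝓡 3) X) (H₀ : ℝ), InitialDataSet.IsSmoothDataFamily 1 F ∧ F 0 = D ∧ 0 < H₀ ∧ (∀ H : ℝ, 0 < H → H ≤ H₀ → let D' := F (EuclideanSpace.single 0 H); ∀ [D'.metric.HasLeviCivita], (∀ x, D'.hamiltonianConstraintFn x = 6 * H ^ 2 ∧ D'.momentumConstraintFn x = 0) ∧ D'.IsComplete) ∧ ∃ (N : ℕ) (mass spin : Fin N → ℝ) (motion : Fin N → lorentzGroup × E4) (τ₀ : ℝ) (ρ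 : Fin N → ℝ → ℝ) (U₀ : TopologicalSpace.Opens E4) (μ : ℝ → ℝ → ENNReal) (μ₀ : ℝ → ENNReal) (σ : ℝ → ℝ → ℝ → ENNReal) (σ₀ : ℝ → ℝ → ENNReal) (A : ℝ → ℝ → ENNReal) (A₀ : ℝ → ENNReal) (τsep : ℝ → ℝ) (Rg : Fin N → ℝ → ℝ), let B : Fin N → ModelBackground := fun i ↦ boostedKerrBackground (motion i).1 (motion i).2 (mass i) (spin i); let B₀ : ModelBackground := Minkowski.backgroundOn U₀; (∀ i, Kerr.IsSubextremal (mass i) (spin i)) ∧ (∀ i, IsOrthochronous (motion i).1) ∧ (∀ R, Filter.Tendsto (μ R) Filter.atTop (𝓝 0)) ∧ Filter.Tendsto μ₀ Filter.atTop (𝓝 0) ∧ (∀ R T, Filter.Tendsto (fun H ↦ ⨆ τ ∈ Set.Icc (τ₀ + T⁻¹) T, σ H R τ) (𝓝[>] 0) (𝓝 0)) ∧ (∀ T, Filter.Tendsto (fun H ↦ ⨆ τ ∈ Set.Icc (τ₀ + T⁻¹) T, σ₀ H τ) (𝓝[>] 0) (𝓝 0)) ∧ (∀ R τ, A R τ <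 ⊤) ∧ (∀ τ, A₀ τ < ⊤) ∧ (∀ i, Filter.Tendsto (fun τ ↦ μ (Rg i τ) τ) Filter.atTop (𝓝 0)) ∧ (∀ i, Filter.Tendsto (Rg i) Filter.atTop Filter.atTop ∧ ∀ τ, max (Kerr.rPlus (mass i) (spin i)) 0 + 1 ≤ Rg i τ) ∧ (∀ i, Filter.Tendsto (fun t ↦ ρ i t / t) Filter.atTop (𝓝 0)) ∧ {x : E4 | τ₀ < x 0 ∧ ∀ i, ρ i (x 0) < (B i).radius x} ⊆ (U₀ : Set E4) ∧ ∀ H : ℝ, 0 < H → H ≤ H₀ → let IsΛMGHD : CauchyDevelopment (F (EuclideanSpace.single 0 H)) → Prop := fun 𝒟 ↦ 𝒟.IsMaximalAmong (fun 𝒟' ↦ ∀ [𝒟'.metric.toPseudoRiemannianMetric.HasLeviCivita], 𝒟'.metric.toPseudoRiemannianMetric.IsEinsteinVacuum (3 * H ^ 2)); (∃ 𝒟, IsΛMGHD 𝒟) ∧ ∀ 𝒟, IsΛMGHD 𝒟 → HasCompleteNullInfinity 𝒟 ∧ ∃ (Ψ : ∀ i, (B i).domain → 𝒟.carrier) (Ψ₀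 : B₀.domain → 𝒟.carrier), let O : Set 𝒟.carrier := exteriorOf 𝒟 ((⋃ i, Ψ i '' (B i).lateRegion τ₀) ∪ Ψ₀ '' B₀.lateRegion τ₀); (∀ i, 𝒟.toSpacetime.IsLateChart (B i) O τ₀ (Ψ i)) ∧ 𝒟.toSpacetime.IsLateChart B₀ O τ₀ Ψ₀ ∧ (∀ i R τ, τ₀ < τ → 𝒟.toSpacetime.truncDeviationCk (B i) (Ψ i) 2 R τ ≤ μ R τ + σ H R τ) ∧ (∀ τ, τ₀ < τ → 𝒟.toSpacetime.deviationCk B₀ Ψ₀ 2 τ ≤ μ₀ τ + σ₀ H τ) ∧ (∀ i R τ, τ₀ < τ → ∀ x ∈ (B i).truncTimeSlab R τ, ∀ y : X, 𝒟.toSpacetime.lorentzDist (𝒟.embed y) (Ψ i x) ≤ A R τ) ∧ (∀ τ, τ₀ < τ → ∀ x ∈ B₀.timeSlab τ, ∀ y : X, 𝒟.toSpacetime.lorentzDist (𝒟.embed y) (Ψ₀ x) ≤ A₀ τ) ∧ (∀ R τ₁, τsep R ≤ τ₁ → Pairwise (Function.onFun Disjoint fun i ↦ Ψ i '' (B i).truncLateRegion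 τ₁ R)) ∧ RaysStayInClosure 𝒟 O ∧ (∀ i (R : ℝ), ∀ᶠ τ in Filter.atTop, ∀ x ∈ (B i).truncTimeSlab R τ, 𝒟.timeOrientation.IsFutureDirected (mfderiv 𝓘(ℝ, E4) (𝓡 4) (Ψ i) x (((motion i).1 : E4 ≃L[ℝ] E4) (Kerr.timeVector (mass i) (spin i) (poincareInv (motion i).1 (motion i).2 (x : E4)))))) ∧ (∀ᶠ τ in Filter.atTop, ∀ x ∈ B₀.timeSlab τ, 𝒟.timeOrientation.IsFutureDirected (mfderiv 𝓘(ℝ, E4) (𝓡 4) Ψ₀ x (E4.basisVector 0))) ∧ (∀ τ₁, τ₀ < τ₁ → O \ (Ψ₀ '' B₀.lateRegion τ₁ ∪ ⋃ i, Ψ i '' {x | τ₁ < (B i).time x.1 ∧ (B i).radius x.1 ≤ Rg i ((B i).time x.1)}) ⊆ 𝒟.metric.causalPast 𝒟.timeOrientation (Ψ₀ '' B₀.timeSlab τ₁ ∪ ⋃ i, Ψ i '' (B i).truncTimeSlab (Rg i τ₁) τ₁))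

/-- `Φ₀(𝒟)` — an H-FREE LIMIT CHART PACKAGE in the Cauchy development `𝒟` (the Λ = 0 level of `Φ`,
slack-free, with the covering clause at `τ₀` that `FinalStateDecomposition` demands): `N` sub-extremal
Kerr parameter pairs with orthochronous Poincaré motions, a late time `τ₀`, sublinear excisions `ρᵢ`,
a flat domain `U₀ ⊇ {x⁰ > τ₀} ∖ tubes`, moduli `μ(R, ·), μ₀ → 0`, separation times `τsep(R)`, honest
radii `Rgᵢ → ∞` (`≥ max(r₊, 0) + 1`, `μ(Rgᵢ(τ), τ) → 0`), late charts `Ψᵢ` (boosted Kerr exteriors)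
and `Ψ₀` (`U₀`) into `O = J⁺(ιX) ∩ I⁻(Ψ₀(late) ∪ ⋃ᵢ Ψᵢ(late))` with `C²` deviations `≤ μ(R, τ)` on
truncated slabs and `≤ μ₀(τ)` on flat slabs (`τ > τ₀`), tubes pairwise disjoint after `τsep(R)`,
`O ∖ late images ⊆ J⁻(initial slabs)`, eventually future-directed push-forwards of `Λᵢ V_{Mᵢ,aᵢ}`
and `∂₀`, and exhaustiveness of `O` by the certified slabs with radii `Rgᵢ` for every `τ₁ > τ₀`. -/
def LimitChartPackage {X : Type} [TopologicalSpace X] [ChartedSpace E3 X] [IsManifold (𝓡 3) ∞ X]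
    [ConnectedSpace X] {D : InitialDataSet (𝓡 3) X} (𝒟 : CauchyDevelopment D) : Prop :=
  ∃ (N : ℕ) (mass spin : Fin N → ℝ) (motion : Fin N → lorentzGroup × E4) (τ₀ : ℝ) (ρ : Fin N → ℝ → ℝ)
    (U₀ : TopologicalSpace.Opens E4) (μ : ℝ → ℝ → ENNReal) (μ₀ : ℝ → ENNReal) (τsep : ℝ → ℝ)
    (Rg : Fin N → ℝ → ℝ),
    let B : Fin N → ModelBackground := fun i ↦ boostedKerrBackground (motion i).1 (motion i).2 (mass i) (spin i)
    let B₀ : ModelBackground := Minkowski.backgroundOn U₀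
    (∀ i, Kerr.IsSubextremal (mass i) (spin i)) ∧ (∀ i, IsOrthochronous (motion i).1) ∧
    (∀ R, Filter.Tendsto (μ R) Filter.atTop (𝓝 0)) ∧ Filter.Tendsto μ₀ Filter.atTop (𝓝 0) ∧
    (∀ i, Filter.Tendsto (fun τ ↦ μ (Rg i τ) τ) Filter.atTop (𝓝 0)) ∧
    (∀ i, Filter.Tendsto (Rg i) Filter.atTop Filter.atTop ∧ ∀ τ, max (Kerr.rPlus (mass i) (spin i)) 0 + 1 ≤ Rg i τ) ∧
    (∀ i, Filter.Tendsto (fun t ↦ ρ i t / t) Filter.atTop (𝓝 0)) ∧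
    {x : E4 | τ₀ < x 0 ∧ ∀ i, ρ i (x 0) < Kerr.radius (spin i) (poincareInv (motion i).1 (motion i).2 x)} ⊆ (U₀ : Set E4) ∧
    ∃ (Ψ : ∀ i, (B i).domain → 𝒟.carrier) (Ψ₀ : B₀.domain → 𝒟.carrier) (O : Set 𝒟.carrier),
      O = exteriorOf 𝒟 (Ψ₀ '' B₀.lateRegion τ₀ ∪ ⋃ i, Ψ i '' (B i).lateRegion τ₀) ∧
      (∀ i, 𝒟.toSpacetime.IsLateChart (B i) O τ₀ (Ψ i)) ∧ 𝒟.toSpacetime.IsLateChart B₀ O τ₀ Ψ₀ ∧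
      (∀ i R τ, τ₀ < τ → 𝒟.toSpacetime.truncDeviationCk (B i) (Ψ i) 2 R τ ≤ μ R τ) ∧
      (∀ τ, τ₀ < τ → 𝒟.toSpacetime.deviationCk B₀ Ψ₀ 2 τ ≤ μ₀ τ) ∧
      (∀ R τ₁, τsep R ≤ τ₁ → Pairwise (Function.onFun Disjoint fun i ↦ Ψ i '' (B i).truncLateRegion τ₁ R)) ∧
      O \ ((⋃ i, Ψ i '' (B i).lateRegion τ₀) ∪ Ψ₀ '' B₀.lateRegion τ₀) ⊆
        𝒟.metric.causalPast 𝒟.timeOrientation ((⋃ i, Ψ i '' (B i).timeSlab τ₀) ∪ Ψ₀ '' B₀.timeSlab τ₀) ∧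
      (∀ i (R : ℝ), ∀ᶠ τ in Filter.atTop, ∀ x ∈ (B i).truncTimeSlab R τ,
        𝒟.timeOrientation.IsFutureDirected (mfderiv 𝓘(ℝ, E4) (𝓡 4) (Ψ i) x
          (((motion i).1 : E4 ≃L[ℝ] E4) (Kerr.timeVector (mass i) (spin i) (poincareInv (motion i).1 (motion i).2 (x : E4)))))) ∧
      (∀ᶠ τ in Filter.atTop, ∀ x ∈ B₀.timeSlab τ,
        𝒟.timeOrientation.IsFutureDirected (mfderiv 𝓘(ℝ, E4) (𝓡 4) Ψ₀ x (E4.basisVector 0))) ∧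
      (∀ τ₁, τ₀ < τ₁ → O \ (Ψ₀ '' B₀.lateRegion τ₁ ∪ ⋃ i, Ψ i '' {x | τ₁ < (B i).time x.1 ∧ (B i).radius x.1 ≤ Rg i ((B i).time x.1)}) ⊆
        𝒟.metric.causalPast 𝒟.timeOrientation (Ψ₀ '' B₀.timeSlab τ₁ ∪ ⋃ i, Ψ i '' (B i).truncTimeSlab (Rg i τ₁) τ₁))

/-! ## Statements of the three stubs as named propositions (the skeleton audit reads the hypotheses of
`LimitTransport_of` BY NAME: each head must be a declared stub, whence the `Goal.stub_*` abbreviations). -/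

/-- Statement of `stub_chartTransport` (CAUCHY-STABILITY TRANSPORT OF THE ANCHORED CHARTS). -/
def ChartTransport : Prop := ∀ (X : Type) [TopologicalSpace X] [ChartedSpace E3 X] [IsManifold (𝓡 3) ∞ X] [T2Space X] [SecondCountableTopology X] [ConnectedSpace X], ∀ D ∈ admissibleVacuumData X, AnchoredSettling X D → ∀ 𝒟 : VacuumCauchyDevelopment D, 𝒟.IsMaximal → LimitChartPackage 𝒟.toCauchyDevelopment

/-- Statement of `stub_scriTransport` (COMPLETE `𝓘⁺` OF THE Λ = 0 MGHD). -/
def ScriTransport : Prop := ∀ (X : Type) [TopologicalSpace X] [ChartedSpace E3 X] [IsManifold (𝓡 3) ∞ X] [T2Space X] [SecondCountableTopology X] [ConnectedSpace X], ∀ D ∈ admissibleVacuumData X, AnchoredSettling X D → ∀ 𝒟 : VacuumCauchyDevelopment D, 𝒟.IsMaximal → ∀ (O : Set 𝒟.carrier) (d : FinalStateDecomposition 𝒟.toSpacetime O 2), (∀ i, Kerr.IsSubextremal (d.mass i) (d.spin i)) → O = exteriorOf 𝒟.toCauchyDevelopment d.charted → HasExhaustiveCharts d → IsFutureOriented d →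 HasCompleteNullInfinity 𝒟.toCauchyDevelopment

/-- Statement of `stub_raysTransport` (COMPLETE RAYS STAY IN THE CLOSED SETTLED EXTERIOR). -/
def RaysTransport : Prop := ∀ (X : Type) [TopologicalSpace X] [ChartedSpace E3 X] [IsManifold (𝓡 3) ∞ X] [T2Space X] [SecondCountableTopology X] [ConnectedSpace X], ∀ D ∈ admissibleVacuumData X, AnchoredSettling X D → ∀ 𝒟 : VacuumCauchyDevelopment D, 𝒟.IsMaximal → HasCompleteNullInfinity 𝒟.toCauchyDevelopment → ∀ (O : Set 𝒟.carrier) (d : FinalStateDecomposition 𝒟.toSpacetime O 2), (∀ i, Kerr.IsSubextremal (d.mass i) (d.spin i)) → O = exteriorOf 𝒟.toCauchyDevelopment d.charted → HasExhaustiveCharts d → IsFutureOriented d → RaysStayInClosure 𝒟.toCauchyDevelopment O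

namespace Goal
/-- Statement of `stub_chartTransport`, under the stub's name. -/
abbrev stub_chartTransport : Prop := ChartTransport
/-- Statement of `stub_scriTransport`, under the stub's name. -/
abbrev stub_scriTransport : Prop := ScriTransport
/-- Statement of `stub_raysTransport`, under the stub's name. -/
abbrev stub_raysTransport : Prop := RaysTransport
end Goal

/-! ## Registered stubs (the only `sorry`s of the file), stated expanded. -/

/-- stub 1 — CAUCHY-STABILITY TRANSPORT OF THE ANCHORED CHARTS (load-bearing): the anchored uniform
Λ-settling property `Φ(D)` of an admissible Λ = 0 datum ⇒ every Λ = 0 MGHD of `D` carries an H-free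
limit chart package (slack-free `C²` bounds, disjoint tubes, covering at `τ₀`, future-directed
push-forwards, exhaustiveness with honest radii). -/
theorem stub_chartTransport : ∀ (X : Type) [TopologicalSpace X] [ChartedSpace E3 X] [IsManifold (𝓡 3) ∞ X] [T2Space X] [SecondCountableTopology X] [ConnectedSpace X], ∀ D ∈ admissibleVacuumData X, AnchoredSettling X D → ∀ 𝒟 : VacuumCauchyDevelopment D, 𝒟.IsMaximal → LimitChartPackage 𝒟.toCauchyDevelopment := by
  sorry

/-- stub 2 — COMPLETE `𝓘⁺` OF THE Λ = 0 MGHD: under `Φ(D)`, a Λ = 0 MGHD of `D` carrying a settled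
exterior `(O, d)` (sub-extremal holes, `O = exteriorOf 𝒟 d.charted`, exhaustive honest-radius charts,
future-oriented chart times) has complete future null infinity in the sojourn form. -/
theorem stub_scriTransport : ∀ (X : Type) [TopologicalSpace X] [ChartedSpace E3 X] [IsManifold (𝓡 3) ∞ X] [T2Space X] [SecondCountableTopology X] [ConnectedSpace X], ∀ D ∈ admissibleVacuumData X, AnchoredSettling X D → ∀ 𝒟 : VacuumCauchyDevelopment D, 𝒟.IsMaximal → ∀ (O : Set 𝒟.carrier) (d : FinalStateDecomposition 𝒟.toSpacetime O 2), (∀ i, Kerr.IsSubextremal (d.mass i) (d.spin i)) → O = exteriorOf 𝒟.toCauchyDevelopment d.charted → HasExhaustiveCharts d → IsFutureOriented d → HasCompleteNullInfinity 𝒟.toCauchyDevelopment := by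
  sorry

/-- stub 3 — COMPLETE RAYS STAY IN THE CLOSED SETTLED EXTERIOR: under `Φ(D)`, in a Λ = 0 MGHD of `D`
with complete `𝓘⁺`, every settled exterior `(O, d)` as above holds every future-complete normalised
null ray from `Σ` in `closure O` (implied by the shared crux `SettledExteriorHoldsRays`). -/
theorem stub_raysTransport : ∀ (X : Type) [TopologicalSpace X] [ChartedSpace E3 X] [IsManifold (𝓡 3) ∞ X] [T2Space X] [SecondCountableTopology X] [ConnectedSpace X], ∀ D ∈ admissibleVacuumData X, AnchoredSettling X D → ∀ 𝒟 : VacuumCauchyDevelopment D, 𝒟.IsMaximal → HasCompleteNullInfinity 𝒟.toCauchyDevelopment → ∀ (O : Set 𝒟.carrier) (d : FinalStateDecomposition 𝒟.toSpacetime O 2), (∀ i, Kerr.IsSubextremal (d.mass i) (d.spin i)) → O = exteriorOf 𝒟.toCauchyDevelopment d.charted → HasExhaustiveCharts d → IsFutureOriented d → RaysStayInClosure 𝒟.toCauchyDevelopment O := by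
  sorry

/-! Consistency (elaborated, not kept in the environment): each expanded stub statement is, by
`δ`-unfolding, the named proposition the composition consumes. -/
example : Goal.stub_chartTransport := stub_chartTransport
example : Goal.stub_scriTransport := stub_scriTransport
example : Goal.stub_raysTransport := stub_raysTransport

/-! ## Sorry-free glue used by the composition -/

/-- Squeeze in `ℝ≥0∞`: a function dominated after `τ₀` by a null function tends to `0`. -/
theorem tendsto_zero_of_le_after {f g : ℝ → ENNReal} {τ₀ : ℝ}
    (hg : Tendsto g atTop (𝓝 0)) (h : ∀ τ, τ₀ < τ → f τ ≤ g τ) : Tendsto f atTop (𝓝 0) :=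
  tendsto_of_tendsto_of_tendsto_of_le_of_le' tendsto_const_nhds hg
    (Eventually.of_forall fun _ ↦ zero_le) ((eventually_gt_atTop τ₀).mono fun τ hτ ↦ h τ hτ)

/-! ## The composition (kernel-checked; no `sorry` of its own) -/

/-- THE CRUX BY NAME from the three registered stubs: the limit chart package of
`stub_chartTransport` is assembled into a `C²` final-state decomposition `d` of its own exterior `O`
(positivity of masses from sub-extremality; convergence fields and honest-radius convergence by
squeezing; eventual disjointness from the separation times; covering, exhaustiveness and orientation
verbatim; `O = exteriorOf 𝒟 d.charted` by `rfl`), `stub_scriTransport` supplies complete `𝓘⁺` and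
`stub_raysTransport` the ray clause. -/
theorem LimitTransport_of :
    Goal.stub_chartTransport → Goal.stub_scriTransport → Goal.stub_raysTransport →
      Summit.FinalStateConjecture.FinalStateConjecture.Theses.LambdaRegulator.LimitTransport := by
  intro h₁ h₂ h₃ X _ _ _ _ _ _ D hD hΦ 𝒟 hmax
  obtain ⟨N, mass, spin, motion, τ₀, ρ, U₀, μ, μ₀, τsep, Rg, hsub, horth, hμ, hμ₀, hμRg, hRg, hρ,
    hU₀, Ψ, Ψ₀, O, hO, hlate, hlate₀, hdev, hdev₀, hsep, hcov, hfut, hfut₀, hexh⟩ :=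
    h₁ X D hD hΦ 𝒟 hmax
  -- the limit package as a `C²` final-state decomposition of its own exterior `O`
  let d : FinalStateDecomposition 𝒟.toSpacetime O 2 :=
    { N := N
      mass := mass
      spin := spin
      mass_pos := fun i ↦ (abs_nonneg (spin i)).trans_lt (hsub i)
      abs_spin_le_mass := fun i ↦ le_of_lt (hsub i)
      motion := motion
      τ₀ := τ₀
      chart := Ψ
      isLateChart := hlate
      tendsto_truncDeviationCk := fun i R ↦
        tendsto_zero_of_le_after (hμ R) fun τ hτ ↦ hdev i R τ hτ
      exists_pairwise_disjoint := fun R ↦ ⟨τsep R, hsep R (τsep R) le_rfl⟩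
      excision := ρ
      tendsto_excision_div := hρ
      flatDomain := U₀
      setOf_lt_excision_subset_flatDomain := hU₀
      flatChart := Ψ₀
      isLateChart_flat := hlate₀
      tendsto_deviationCk_flat := tendsto_zero_of_le_after hμ₀ fun τ hτ ↦ hdev₀ τ hτ
      diff_subset_causalPast := hcov }
  have hsubd : ∀ i, Kerr.IsSubextremal (d.mass i) (d.spin i) := hsub
  have hOd : O = exteriorOf 𝒟.toCauchyDevelopment d.charted := hO
  have hexhd : HasExhaustiveCharts d :=
    ⟨Rg, hRg, fun i ↦ tendsto_zero_of_le_after (hμRg i) fun τ hτ ↦ hdev i (Rg i τ) τ hτ, hexh⟩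
  have hfutd : IsFutureOriented d := ⟨horth, hfut, hfut₀⟩
  have hscri : HasCompleteNullInfinity 𝒟.toCauchyDevelopment :=
    h₂ X D hD hΦ 𝒟 hmax O d hsubd hOd hexhd hfutd
  exact ⟨hscri, O, d, hsubd, hOd, h₃ X D hD hΦ 𝒟 hmax hscri O d hsubd hOd hexhd hfutd, hexhd, hfutd⟩

end Summit.FinalStateConjecture.FinalStateConjecture.Cruxes.LimitTransport.Birth
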